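import Mathlib
import HarnessLib

/-!
# Sparse dyadic rationals and rational approximation (Harman–Kátai; Green 2012, §4)

Topic `Literature/NumberTheory/DiophantineApproximation`. Everything in this file is PROVED.

Two elementary Diophantine lemmas from B. Green, *On (not) computing the Möbius function using
bounded depth circuits*, Combin. Probab. Comput. 21 (2012) 942–951 (arXiv:1103.4991), §4, which
are the glue between the minor-arc exponential-sum bound for `μ` / `λ` and the major arcs at
`2`-power denominators in the proof of his Proposition 1 (Fourier–Walsh coefficients of `μ`):

* `exists_rat_of_minorArcBound` — the deduction "large exponential sum ⟹ `θ` is close to a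
  rational with small denominator" (Green's **Proposition 4**, abstract form): if a quantity `S`
  obeys a Vinogradov-type bound `‖S‖ ≤ B (N/√q + N^{9/10} + √N √q)` whenever
  `|θ - a/q| ≤ q⁻²`, `(a, q) = 1`, `1 ≤ q ≤ N`, and `‖S‖ ≥ δ N`, then (Dirichlet's approximation
  theorem, Mathlib's `Real.exists_rat_abs_sub_le_and_den_le`) there is a reduced `a/q` with
  `q ≤ 16 B²/δ²` and `|θ - a/q| ≤ 16 B²/(δ² q N)`, provided `4B ≤ δ N^{1/10}`, `16 B² ≤ δ² N`,
  `δ ≤ 4 B`. (In the tree it is applied with `S = Σ_{n ≤ N} μ(n) e(nθ)`, `B = 2240 (log N)⁴`,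
  `Literature/NumberTheory/Sieve/MoebiusExpSum.lean`.)
* `HarmanKatai.eq_two_pow_of_sparseDyadic` — **Lemma 1** (the observation of G. Harman and
  I. Kátai, *Primes with preassigned digits II*, Acta Arith. 133 (2008), as formulated by Green):
  if `θ = Σ_{i ∈ I} r_i / 2^i` with `I ⊆ ℕ` finite, `|I| ≤ k`, `|r_i| ≤ Q`, and `θ` is within
  `Q/2^n` of a reduced fraction `a/q` with `q ≤ Q`, and `2^{n/2k} > 4Q²`, then `q` is a power of
  two. Proof as printed: by pigeonhole there is a gap of length `≥ n/2k` in `I ∪ {0, n}` starting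
  at some `p ∈ I ∪ {0}`; then `θ` is within `2Q·2^{-n/2k}/q'` of `a'/q'`, `q' = 2^p ≤ 2^{-n/2k} N`,
  and two distinct fractions cannot be that close, so `a/q = a'/2^p` and `q ∣ 2^p`.
  (We run the pigeonhole over the `2k` intervals `[mg, (m+1)g)`, `g = n/2k`, at least `k` of which
  miss `I`; the gap starts at the largest element of `I ∪ {0}` below a free interval.)

## References

* B. Green, Combin. Probab. Comput. 21 (2012) 942–951, §4: Proposition 4 and Lemma 1. [Green2012]
* G. Harman, I. Kátai, *Primes with preassigned digits II*, Acta Arith. 133 (2008) 171–184.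
-/

noncomputable section

open Finset Real

namespace Literature.NumberTheory.DiophantineApproximation

/-! ### Large exponential sums live on major arcs (Green 2012, Proposition 4, abstract form) -/

/-- A reduced fraction from a rational number: `r = r.num / r.den` with `IsCoprime r.num r.den`.
[folklore] -/
theorem isCoprime_num_den (r : ℚ) : IsCoprime r.num (r.den : ℤ) :=
  Int.isCoprime_iff_gcd_eq_one.mpr r.reduced

/-- **Green 2012, Proposition 4 (abstract form).** Let `N ≥ 2`, `θ ∈ ℝ`, and let `S` satisfy the
minor-arc bound `‖S‖ ≤ B (N/√q + N^{9/10} + √N √q)` for every reduced `a/q` with `1 ≤ q ≤ N`,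
`|θ - a/q| ≤ q⁻²`. If `‖S‖ ≥ δN` with `δ > 0`, `4B ≤ δ N^{1/10}`, `16 B² ≤ δ² N` and `δ ≤ 4B`,
then there is a reduced fraction `a/q` with `1 ≤ q ≤ 16 B²/δ²` and `|θ - a/q| ≤ 16 B²/(δ² q N)`.
(Printed for `S = Σ_{x < N} μ(x) e(θx)`: "Suppose that `|μ̂(θ)| ≥ δ`. Then there is some
`q ≪ (log N/δ)^{16}` such that `|θ - a/q| ≪ (log N/δ)^{16} N^{-1}`"; here with the exponents the
tree's bound gives.) Proof: Dirichlet's theorem with parameter `⌊N/M⌋`, `M = 16B²/δ²`, produces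
`a/q` with `q ≤ N/M` and `|θ - a/q| ≤ M/(qN) ≤ q⁻²`; if `q > M` all three terms of the bound are
`< δN/4B`, contradicting `‖S‖ ≥ δN`. [cite: Green2012, Proposition 4] -/
theorem exists_rat_of_minorArcBound {N : ℕ} (hN : 2 ≤ N) {θ : ℝ} {S : ℂ} {B δ : ℝ}
    (hB : 0 < B) (hδ : 0 < δ)
    (H : ∀ (a : ℤ) (q : ℕ), 1 ≤ q → q ≤ N → IsCoprime a (q : ℤ) → |θ - a / q| ≤ 1 / (q : ℝ) ^ 2 →
      ‖S‖ ≤ B * ((N : ℝ) / Real.sqrt q + (N : ℝ) ^ (9 / 10 : ℝ) + Real.sqrt N * Real.sqrt q))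
    (hS : δ * N ≤ ‖S‖) (h1 : 4 * B ≤ δ * (N : ℝ) ^ (1 / 10 : ℝ)) (h2 : 16 * B ^ 2 ≤ δ ^ 2 * N)
    (h3 : δ ≤ 4 * B) :
    ∃ (a : ℤ) (q : ℕ), 1 ≤ q ∧ (q : ℝ) ≤ 16 * B ^ 2 / δ ^ 2 ∧ IsCoprime a (q : ℤ) ∧
      |θ - a / q| ≤ 16 * B ^ 2 / (δ ^ 2 * q * N) := by
  have hN0 : (0 : ℝ) < N := by exact_mod_cast lt_of_lt_of_le (by norm_num) hN
  have hN1 : (1 : ℝ) ≤ N := by exact_mod_cast le_trans (by norm_num) hN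
  set M : ℝ := 16 * B ^ 2 / δ ^ 2 with hM
  have hM0 : 0 < M := by positivity
  have hM1 : 1 ≤ M := by
    rw [hM, le_div_iff₀ (by positivity)]
    nlinarith
  have hMN : M ≤ N := by
    rw [hM, div_le_iff₀ (by positivity)]
    linarith
  have hsqrtM : Real.sqrt M = 4 * B / δ := by
    rw [hM, show (16 : ℝ) * B ^ 2 / δ ^ 2 = (4 * B / δ) ^ 2 by ring]
    exact Real.sqrt_sq (by positivity)
  -- Dirichlet with parameter `n₀ = ⌊N/M⌋ ≥ 1`
  set n₀ : ℕ := ⌊(N : ℝ) / M⌋₊ with hn₀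
  have hNM1 : 1 ≤ (N : ℝ) / M := by rwa [le_div_iff₀ hM0, one_mul]
  have hn₀1 : 1 ≤ n₀ := Nat.le_floor (by exact_mod_cast hNM1)
  have hn₀le : (n₀ : ℝ) ≤ N / M := Nat.floor_le (by positivity)
  have hn₀lt : (N : ℝ) / M < n₀ + 1 := Nat.lt_floor_add_one _
  obtain ⟨r, hr, hden⟩ := Real.exists_rat_abs_sub_le_and_den_le θ (by omega : 0 < n₀)
  set q : ℕ := r.den with hq
  have hq1 : 1 ≤ q := r.den_pos
  have hq0 : (0 : ℝ) < q := by exact_mod_cast hq1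
  have hqn₀ : (q : ℝ) ≤ n₀ := by exact_mod_cast hden
  have hqNM : (q : ℝ) ≤ N / M := hqn₀.trans hn₀le
  have hqN : q ≤ N := by
    have : (q : ℝ) ≤ N := hqNM.trans (div_le_self hN0.le hM1)
    exact_mod_cast this
  have hrq : ((r.num : ℝ) / (q : ℕ) : ℝ) = (r : ℝ) := by rw [hq, Rat.cast_def]
  have hθ1 : |θ - r.num / q| ≤ 1 / ((n₀ + 1) * q) := by rw [hrq]; exact hr
  have hθ2 : |θ - r.num / q| ≤ 1 / (q : ℝ) ^ 2 := by
    refine hθ1.trans ?_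
    rw [sq]
    refine one_div_le_one_div_of_le (by positivity) ?_
    exact mul_le_mul_of_nonneg_right (by linarith) hq0.le
  have hθ3 : |θ - r.num / q| ≤ M / (q * N) := by
    refine hθ1.trans ?_
    rw [div_le_div_iff₀ (by positivity) (by positivity), one_mul]
    have : (N : ℝ) < (n₀ + 1) * M := by rwa [div_lt_iff₀ hM0] at hn₀lt
    nlinarith
  have hbound := H r.num q hq1 hqN (isCoprime_num_den r) hθ2
  -- `q ≤ M`, else the bound contradicts `‖S‖ ≥ δ N`
  have hqM : (q : ℝ) ≤ M := by
    by_contra hcon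
    push Not at hcon
    have hT1 : (N : ℝ) / Real.sqrt q < N * δ / (4 * B) := by
      have hsq : Real.sqrt M < Real.sqrt q := Real.sqrt_lt_sqrt hM0.le hcon
      rw [hsqrtM] at hsq
      have h4 : 0 < 4 * B / δ := by positivity
      calc (N : ℝ) / Real.sqrt q < N / (4 * B / δ) := div_lt_div_of_pos_left hN0 h4 hsq
        _ = N * δ / (4 * B) := by field_simp
    have hT2 : (N : ℝ) ^ (9 / 10 : ℝ) ≤ N * δ / (4 * B) := by
      rw [le_div_iff₀ (by positivity)]
      have e : (N : ℝ) = (N : ℝ) ^ (1 / 10 : ℝ) * (N : ℝ) ^ (9 / 10 : ℝ) := by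
        rw [← Real.rpow_add hN0]; norm_num
      have h9 : 0 ≤ (N : ℝ) ^ (9 / 10 : ℝ) := Real.rpow_nonneg hN0.le _
      calc (N : ℝ) ^ (9 / 10 : ℝ) * (4 * B) = 4 * B * (N : ℝ) ^ (9 / 10 : ℝ) := by ring
        _ ≤ δ * (N : ℝ) ^ (1 / 10 : ℝ) * (N : ℝ) ^ (9 / 10 : ℝ) := mul_le_mul_of_nonneg_right h1 h9
        _ = N * δ := by rw [mul_assoc, ← e]; ring
    have hT3 : Real.sqrt N * Real.sqrt q ≤ N * δ / (4 * B) := by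
      have hqle : (q : ℝ) ≤ N / M := hqNM
      calc Real.sqrt N * Real.sqrt q ≤ Real.sqrt N * Real.sqrt (N / M) :=
            mul_le_mul_of_nonneg_left (Real.sqrt_le_sqrt hqle) (Real.sqrt_nonneg _)
        _ = N / Real.sqrt M := by
            rw [Real.sqrt_div' _ hM0.le, ← mul_div_assoc, Real.mul_self_sqrt hN0.le]
        _ = N * δ / (4 * B) := by rw [hsqrtM]; field_simp
    have hsum : B * ((N : ℝ) / Real.sqrt q + (N : ℝ) ^ (9 / 10 : ℝ) + Real.sqrt N * Real.sqrt q) <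
        δ * N := by
      have : (N : ℝ) / Real.sqrt q + (N : ℝ) ^ (9 / 10 : ℝ) + Real.sqrt N * Real.sqrt q <
          3 * (N * δ / (4 * B)) := by linarith
      calc B * ((N : ℝ) / Real.sqrt q + (N : ℝ) ^ (9 / 10 : ℝ) + Real.sqrt N * Real.sqrt q)
          < B * (3 * (N * δ / (4 * B))) := mul_lt_mul_of_pos_left this hB
        _ = 3 / 4 * (δ * N) := by field_simp
        _ < δ * N := by nlinarith [mul_pos hδ hN0]
    linarith
  refine ⟨r.num, q, hq1, hqM, isCoprime_num_den r, hθ3.trans (le_of_eq ?_)⟩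
  rw [hM]
  field_simp

/-! ### Sparse dyadic rationals (Harman–Kátai; Green 2012, Lemma 1) -/

namespace HarmanKatai

/-- **The gap.** If `I ⊆ ℕ` has at most `k ≥ 1` elements and `g = n/2k`, there is `p ∈ I ∪ {0}`
with `p + g ≤ n` such that every element of `I` beyond `p` is `≥ p + g` (pigeonhole over the
`2k` intervals `[mg, (m+1)g)`, at least one of which misses `I`; `p` is the largest element of
`I ∪ {0}` below it). [cite: Green2012, Lemma 1 (proof)] -/
theorem exists_gap {n k : ℕ} (hk : 1 ≤ k) {I : Finset ℕ} (hIk : I.card ≤ k) :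
    ∃ p : ℕ, (p = 0 ∨ p ∈ I) ∧ (p : ℝ) + n / (2 * k) ≤ n ∧
      ∀ i ∈ I, p < i → (p : ℝ) + n / (2 * k) ≤ i := by
  set g : ℝ := n / (2 * k) with hg
  have hk0 : (0 : ℝ) < k := by exact_mod_cast hk
  have hg0 : 0 ≤ g := by positivity
  have hgn : 2 * k * g = n := by rw [hg]; field_simp
  -- a free interval `[m g, (m+1) g)`, `m < 2k`
  classical
  obtain ⟨m, hm, hfree⟩ : ∃ m ∈ range (2 * k), m ∉ I.image (fun i : ℕ => ⌊(i : ℝ) / g⌋₊) := by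
    apply Finset.exists_mem_notMem_of_card_lt_card
    calc (I.image fun i : ℕ => ⌊(i : ℝ) / g⌋₊).card ≤ I.card := Finset.card_image_le
      _ ≤ k := hIk
      _ < 2 * k := by omega
      _ = (range (2 * k)).card := (Finset.card_range _).symm
  have hm2k : m < 2 * k := Finset.mem_range.mp hm
  have hfree' : ∀ i ∈ I, ¬ ((m : ℝ) * g ≤ i ∧ (i : ℝ) < (m + 1) * g) := by
    intro i hi hcon
    apply hfree
    refine Finset.mem_image.mpr ⟨i, hi, ?_⟩
    rcases eq_or_lt_of_le hg0 with hg00 | hgpos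
    · -- `g = 0`: then `m g = (m+1) g = 0`, the interval is empty
      exfalso
      rw [← hg00, mul_zero, mul_zero] at hcon
      linarith [hcon.1, hcon.2, (Nat.cast_nonneg i : (0 : ℝ) ≤ i)]
    · rw [Nat.floor_eq_iff (by positivity)]
      constructor
      · rw [le_div_iff₀ hgpos]; exact hcon.1
      · rw [div_lt_iff₀ hgpos]; exact hcon.2
  have hm1g : ((m : ℝ) + 1) * g ≤ n := by
    have : (m : ℝ) + 1 ≤ 2 * k := by exact_mod_cast hm2k
    calc ((m : ℝ) + 1) * g ≤ 2 * k * g := mul_le_mul_of_nonneg_right this hg0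
      _ = n := hgn
  rcases Nat.eq_zero_or_pos m with hm0 | hmpos
  · -- the first interval is free: `p = 0`
    refine ⟨0, Or.inl rfl, ?_, fun i hi hi0 => ?_⟩
    · push_cast; rw [hm0] at hm1g; simpa using hm1g
    · push_cast
      by_contra hcon
      push Not at hcon
      apply hfree' i hi
      rw [hm0]; push_cast
      exact ⟨by simp, by simpa using hcon⟩
  · -- `p` = the largest element of `I ∪ {0}` below `m g`
    set P : Finset ℕ := (insert 0 I).filter (fun p : ℕ => (p : ℝ) < m * g) with hP
    have hmg0 : (0 : ℝ) < m * g ∨ (m : ℝ) * g = 0 := by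
      rcases eq_or_lt_of_le hg0 with hg00 | hgpos
      · right; rw [← hg00, mul_zero]
      · left; exact mul_pos (by exact_mod_cast hmpos) hgpos
    rcases hmg0 with hmg0 | hmg0
    · have h0P : 0 ∈ P := by
        rw [hP, Finset.mem_filter]
        exact ⟨Finset.mem_insert_self 0 I, by simpa using hmg0⟩
      have hPne : P.Nonempty := ⟨0, h0P⟩
      set p := P.max' hPne with hp
      have hpP : p ∈ P := Finset.max'_mem P hPne
      rw [hP, Finset.mem_filter, Finset.mem_insert] at hpP
      refine ⟨p, hpP.1, ?_, fun i hi hpi => ?_⟩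
      · linarith [hpP.2]
      · -- `i > p`, `i ∈ I`: not below `m g` (maximality), not in the free interval, so `≥ (m+1) g`
        have hi1 : ¬ (i : ℝ) < m * g := by
          intro hcon
          have hiP : i ∈ P := by
            rw [hP, Finset.mem_filter, Finset.mem_insert]
            exact ⟨Or.inr hi, hcon⟩
          have := Finset.le_max' P i hiP
          rw [← hp] at this
          omega
        have hi2 := hfree' i hi
        push Not at hi1 hi2
        have := hi2 hi1
        linarith [hpP.2]
    · -- degenerate `g = 0` with `m ≥ 1` cannot occur unless `n = 0`; then everything is trivial
      have hg00 : g = 0 := by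
        rcases mul_eq_zero.mp hmg0 with h | h
        · exfalso; exact_mod_cast (ne_of_gt hmpos) (by exact_mod_cast h : m = 0)
        · exact h
      refine ⟨0, Or.inl rfl, ?_, fun i _ _ => ?_⟩
      · rw [hg00]; simp
      · rw [hg00]; simp

/-- The tail of a dyadic series over distinct exponents `≥ i₀` is at most `2 · 2^{-i₀}`:
`Σ_{i ∈ T} 2^{-i} ≤ 2^{1 - i₀}` for `T ⊆ [i₀, ∞)`. [folklore] -/
theorem sum_inv_two_pow_le {T : Finset ℕ} {i₀ : ℕ} (hT : ∀ i ∈ T, i₀ ≤ i) :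
    ∑ i ∈ T, (1 / 2 : ℝ) ^ i ≤ 2 * (1 / 2 : ℝ) ^ i₀ := by
  classical
  set M := T.sup id + 1 with hM
  have hsub : T ⊆ Ico i₀ M := by
    intro i hi
    rw [Finset.mem_Ico]
    exact ⟨hT i hi, Nat.lt_succ_of_le (Finset.le_sup (f := id) hi)⟩
  calc ∑ i ∈ T, (1 / 2 : ℝ) ^ i ≤ ∑ i ∈ Ico i₀ M, (1 / 2 : ℝ) ^ i :=
        Finset.sum_le_sum_of_subset_of_nonneg hsub fun _ _ _ => by positivity
    _ ≤ (1 / 2 : ℝ) ^ i₀ / (1 - 1 / 2) := geom_sum_Ico_le_of_lt_one (by norm_num) (by norm_num)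
    _ = 2 * (1 / 2 : ℝ) ^ i₀ := by ring

/-- **Harman–Kátai / Green 2012, Lemma 1.** "Suppose that `θ = r_1/2^{i_1} + ⋯ + r_k/2^{i_k}`,
where `i_1 < ⋯ < i_k ≤ n` and `|r_i| ≤ Q` for all `i`. Suppose furthermore that there is some
`q ≤ Q` and an `a` coprime to `q` such that `|θ - a/q| ≤ Q/N`, and that we have `2^{n/2k} > 4Q²`.
Then `q` is a power of two." (`N = 2^n`.) Here the exponents form a finset `I ⊆ ℕ` with `|I| ≤ k`,
`k ≥ 1`, and `θ = Σ_{i ∈ I} r_i/2^i`; the printed restriction `i_j ≤ n` turns out not to be needed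
(exponents beyond `n` only shrink the tail). [cite: Green2012, Lemma 1] -/
theorem eq_two_pow_of_sparseDyadic {n k : ℕ} (hk : 1 ≤ k) {I : Finset ℕ} (hIk : I.card ≤ k)
    {r : ℕ → ℤ} {Q : ℝ} (hr : ∀ i ∈ I, |(r i : ℝ)| ≤ Q)
    {θ : ℝ} (hθ : θ = ∑ i ∈ I, (r i : ℝ) / 2 ^ i)
    {a : ℤ} {q : ℕ} (hq1 : 1 ≤ q) (hqQ : (q : ℝ) ≤ Q) (hcop : IsCoprime a (q : ℤ))
    (hnear : |θ - a / q| ≤ Q / 2 ^ n) (hgap : 4 * Q ^ 2 < (2 : ℝ) ^ ((n : ℝ) / (2 * k))) :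
    ∃ t : ℕ, q = 2 ^ t := by
  have hq0 : (0 : ℝ) < q := by exact_mod_cast hq1
  have hQ1 : (1 : ℝ) ≤ Q := le_trans (by exact_mod_cast hq1) hqQ
  have hQ0 : 0 < Q := by linarith
  set g : ℝ := n / (2 * k) with hg
  have hk0 : (0 : ℝ) < k := by exact_mod_cast hk
  have hg0 : 0 ≤ g := by positivity
  -- the gap
  obtain ⟨p, hp0I, hpg, hgapI⟩ := exists_gap (n := n) hk hIk
  -- `q' = 2^p`, `a' = Σ_{i ∈ I, i ≤ p} r_i 2^{p-i}`
  set q' : ℕ := 2 ^ p with hq'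
  set a' : ℤ := ∑ i ∈ I.filter (fun i => i ≤ p), r i * 2 ^ (p - i) with ha'
  have hq'0 : (0 : ℝ) < q' := by rw [hq']; positivity
  have hq'R : (q' : ℝ) = 2 ^ p := by rw [hq']; push_cast; ring
  -- `θ - a'/q' = Σ_{i ∈ I, i > p} r_i / 2^i`
  have hsplit : θ - a' / q' = ∑ i ∈ I.filter (fun i => ¬ i ≤ p), (r i : ℝ) / 2 ^ i := by
    rw [hθ, ← Finset.sum_filter_add_sum_filter_not I (fun i => i ≤ p), ha', hq'R]
    push_cast
    rw [Finset.sum_div, add_sub_right_comm, sub_eq_zero_of_eq, zero_add]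
    refine Finset.sum_congr rfl fun i hi => ?_
    have hip : i ≤ p := (Finset.mem_filter.mp hi).2
    rw [div_eq_div_iff (by positivity) (by positivity), mul_assoc, ← pow_add, Nat.sub_add_cancel hip]
  -- its size: every `i` in the second sum is `≥ p + g`, so the sum is `≤ 2Q 2^{-(p+g)}`
  set i₀ : ℕ := ⌈(p : ℝ) + g⌉₊ with hi₀
  have hi₀ge : (p : ℝ) + g ≤ i₀ := Nat.le_ceil _
  have hTi₀ : ∀ i ∈ I.filter (fun i => ¬ i ≤ p), i₀ ≤ i := by
    intro i hi
    rw [Finset.mem_filter] at hi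
    have h := hgapI i hi.1 (not_le.mp hi.2)
    exact Nat.ceil_le.mpr h
  have htail : |θ - a' / q'| ≤ 2 * Q * (1 / 2 : ℝ) ^ i₀ := by
    rw [hsplit]
    refine (Finset.abs_sum_le_sum_abs _ _).trans ?_
    calc ∑ i ∈ I.filter (fun i => ¬ i ≤ p), |(r i : ℝ) / 2 ^ i|
        ≤ ∑ i ∈ I.filter (fun i => ¬ i ≤ p), Q * (1 / 2 : ℝ) ^ i := by
          refine Finset.sum_le_sum fun i hi => ?_
          rw [abs_div, abs_of_pos (by positivity : (0 : ℝ) < 2 ^ i), one_div_pow, div_eq_mul_one_div]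
          exact mul_le_mul_of_nonneg_right (hr i (Finset.mem_filter.mp hi).1) (by positivity)
      _ = Q * ∑ i ∈ I.filter (fun i => ¬ i ≤ p), (1 / 2 : ℝ) ^ i := by rw [Finset.mul_sum]
      _ ≤ Q * (2 * (1 / 2 : ℝ) ^ i₀) := mul_le_mul_of_nonneg_left (sum_inv_two_pow_le hTi₀) hQ0.le
      _ = 2 * Q * (1 / 2 : ℝ) ^ i₀ := by ring
  -- `(1/2)^{i₀} ≤ 2^{-(p+g)} = 2^{-g}/q'` and `2^{-g} < 1/(4Q²)`
  have h2g : (2 : ℝ) ^ (-g) < 1 / (4 * Q ^ 2) := by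
    rw [Real.rpow_neg (by norm_num), ← one_div]
    exact one_div_lt_one_div_of_lt (by positivity) hgap
  have hhalf : (1 / 2 : ℝ) ^ i₀ ≤ (2 : ℝ) ^ (-g) / q' := by
    rw [hq'R, one_div_pow, one_div, ← Real.rpow_natCast, ← Real.rpow_neg (by norm_num),
      ← Real.rpow_natCast 2 p, div_eq_mul_inv, ← Real.rpow_neg (by norm_num), ← Real.rpow_add (by norm_num)]
    refine Real.rpow_le_rpow_of_exponent_le (by norm_num) ?_
    linarith
  have hnear' : |θ - a' / q'| < 1 / (2 * Q * q') := by
    calc |θ - a' / q'| ≤ 2 * Q * (1 / 2 : ℝ) ^ i₀ := htail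
      _ ≤ 2 * Q * ((2 : ℝ) ^ (-g) / q') := mul_le_mul_of_nonneg_left hhalf (by positivity)
      _ < 2 * Q * (1 / (4 * Q ^ 2) / q') := by
          refine mul_lt_mul_of_pos_left (div_lt_div_of_pos_right h2g hq'0) (by positivity)
      _ = 1 / (2 * Q * q') := by field_simp; ring
  -- `q' ≤ 2^{n-g} < N/(4Q²)`, so `Q/N < 1/(4 Q q')`
  have hq'le : (q' : ℝ) * (4 * Q ^ 2) < 2 ^ n := by
    have h1 : (q' : ℝ) ≤ (2 : ℝ) ^ ((n : ℝ) - g) := by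
      rw [hq'R, ← Real.rpow_natCast]
      exact Real.rpow_le_rpow_of_exponent_le (by norm_num) (by linarith)
    have h2 : (2 : ℝ) ^ ((n : ℝ) - g) * (4 * Q ^ 2) < (2 : ℝ) ^ ((n : ℝ) - g) * (2 : ℝ) ^ g :=
      mul_lt_mul_of_pos_left (by rwa [hg] at hgap ⊢) (by positivity)
    calc (q' : ℝ) * (4 * Q ^ 2) ≤ (2 : ℝ) ^ ((n : ℝ) - g) * (4 * Q ^ 2) :=
          mul_le_mul_of_nonneg_right h1 (by positivity)
      _ < (2 : ℝ) ^ ((n : ℝ) - g) * (2 : ℝ) ^ g := h2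
      _ = 2 ^ n := by rw [← Real.rpow_add (by norm_num), sub_add_cancel, Real.rpow_natCast]
  have hnear2 : |θ - a / q| < 1 / (4 * Q * q') := by
    refine lt_of_le_of_lt hnear ?_
    rw [div_lt_div_iff₀ (by positivity) (by positivity), one_mul]
    nlinarith
  -- hence `|a/q - a'/q'| < 1/(q q')`, forcing `a q' = a' q`
  have hdiff : |(a : ℝ) / q - a' / q'| < 1 / (q * q') := by
    have htri : |(a : ℝ) / q - a' / q'| ≤ |θ - a' / q'| + |θ - a / q| := by
      rw [show (a : ℝ) / q - a' / q' = (θ - a' / q') - (θ - a / q) by ring]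
      exact abs_sub _ _
    have hsum : |θ - a' / q'| + |θ - a / q| < 1 / (2 * Q * q') + 1 / (4 * Q * q') :=
      add_lt_add hnear' hnear2
    have hle : 1 / (2 * Q * q') + 1 / (4 * Q * q') ≤ 1 / (q * q') := by
      rw [show 1 / (2 * Q * q') + 1 / (4 * Q * q') = 3 / (4 * Q * (q' : ℝ)) by field_simp; ring]
      rw [div_le_div_iff₀ (by positivity) (by positivity)]
      nlinarith [mul_pos hq0 hq'0]
    linarith
  have heq : a * q' = a' * q := by
    by_contra hne
    have h1 : (1 : ℝ) ≤ |((a * q' - a' * q : ℤ) : ℝ)| := by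
      rw [← Int.cast_abs]
      exact_mod_cast Int.one_le_abs (sub_ne_zero.mpr hne)
    have h2 : |(a : ℝ) / q - a' / q'| = |((a * q' - a' * q : ℤ) : ℝ)| / (q * q') := by
      rw [show (a : ℝ) / q - a' / q' = ((a * q' - a' * q : ℤ) : ℝ) / (q * q') by push_cast; field_simp,
        abs_div, abs_of_pos (by positivity : (0 : ℝ) < q * q')]
    rw [h2, div_lt_div_iff_of_pos_right (by positivity)] at hdiff
    linarith
  -- `q ∣ a q' = a' q` … so `q ∣ q' = 2^p`
  have hdvd : (q : ℤ) ∣ a * q' := ⟨a', by rw [heq]; ring⟩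
  have hdvd' : (q : ℤ) ∣ (q' : ℤ) := hcop.symm.dvd_of_dvd_mul_left hdvd
  have hdvdN : q ∣ q' := by exact_mod_cast hdvd'
  rw [hq'] at hdvdN
  obtain ⟨t, -, ht⟩ := (Nat.dvd_prime_pow Nat.prime_two).mp hdvdN
  exact ⟨t, ht⟩

end HarmanKatai

end Literature.NumberTheory.DiophantineApproximation
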